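import Summits.AnomalousDissipation.AnomalousDissipation.Theorems.SawtoothPulseCascadeK1LocalisedCascadeRatioBlocksCTG
import Summits.AnomalousDissipation.AnomalousDissipation.Theorems.SawtoothPulseCascadeK1LocalisedCascadeGeomBlocks
import Summits.AnomalousDissipation.AnomalousDissipation.Theorems.SawtoothPulseCascadeK1LocalisedCascadeCanonicalThinBlocks

/-!
# K1loc — helper: RATIO CLASSES ON GEOMETRIC BLOCKS `⌊Λ₀(a/b)^m⌋` IN ALL-ORDERS CORNER-TRACE GRADE, BLOCK SUMS EXPLICIT («CT-GEO»)

Helper file of the prover lane on the crux `K1LocalisedCascade` (stmt-AnomalousDissipation-19491), route `SawtoothPulseCascade`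
(S-D fibre ledger, corner-trace track; finding F-p1g9-1, memo v15).  `…RatioBlocksCTG.tsum_ratioClass_{v,h}step_blocks_ctg_le` on
the geometric block family of `…GeomBlocks` (`Λ_m = ⌊Λ₀(r_a/r_b)^m⌋`, thin cut-offs: support `⌊q_nΛ_m/q_d⌋`, plateau `⌊u′Λ_{m+1}/v′⌋`,
as in `…GeomRatioStepsCTE`) with the box window `vΛ_{m+1}` of the block top (`u = 1`): the family's side conditions reduced to
`m`-uniform inequalities (`hslope`, `hbase`, `hgap`), the four block sums `A, β*, ρ*, Z` kept as EXPLICIT finite sums (numeric layer).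
For the O-V (`v = 4`, `r_a/r_b = 5/4`) and C-H (`v = 3`, `3/2`) windows, where dyadic blocks leave no gap.
No definitions; no statement about the crux. [cite: Grafakos2014, Prop. 3.1.2 (5), Prop. 3.2.7 (3)] [problem: turb]
-/

-- `Summit.<Summit>.<Problem>`: single-conjunct summit, the duplicate namespace segment is deliberate.
set_option linter.dupNamespace false

noncomputable section

namespace Summit.AnomalousDissipation.AnomalousDissipation.Theorems.SawtoothPulseCascade.K1Window

open MeasureTheory Set Filter Topology UnitAddTorus Function Complex Metric
open scoped Real ENNReal
open Literature.Analysis Literature.Analysis.FunctionSpaces Literature.Analysis.FunctionSpaces.Torus Literature.Analysis.FluidPDE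
open Literature.Analysis.FluidPDE.ShearStage
open Literature.Analysis.FluidPDE.SawtoothCascade Literature.Analysis.FluidPDE.SawtoothCascade.CascadeParams
open Summit.AnomalousDissipation.AnomalousDissipation.Theorems.SawtoothPulseCascade.K1Start
open Summit.AnomalousDissipation.AnomalousDissipation.Theorems.SawtoothPulseCascade.K1Flat
open Summit.AnomalousDissipation.AnomalousDissipation.Theorems.SawtoothPulseCascade.K1Ledger.From

section Cascade

variable (P : CascadeParams)

set_option maxHeartbeats 800000 in
/-- Geometric-family instantiation (`Λ_m = ⌊Λ₀(r_a/r_b)^m⌋`, plateau `⌊u′Λ_{m+1}/v′⌋`, support `⌊q_nΛ_m/q_d⌋`, box window `vΛ_{m+1}`, `u = 1`) of `tsum_ratioClass_vstep_blocks_ctg_le`; the finite block sums stay as hypotheses for the numeric layer. [cite: Grafakos2014, Prop. 3.1.2 (5), Prop. 3.2.7 (3)] -/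
theorem ratioClass_vstep_geomExplicitCTG_le {G : ℕ} (hγ : P.γ = G) (hδ₀ : 0 < P.δ₀) (hd : 0 < P.d) (hN₀ : 1 ≤ P.N₀)
    (hρN : 1 ≤ P.ρN) (a b : ℕ → UnitAddTorus (Fin 2) → ℝ) (has : ∀ j, IsSmooth (a j)) (h0 : a 0 = datum)
    (hb : ∀ j, b j = a j ∘ shearMap 0 1 (amp ⟨P.U j, P.U_periodic j, P.contDiff_U (P.δ_pos hδ₀ hd j)⟩ P.γ))
    (hab : ∀ j, a (j + 1) = b j ∘ shearMap 1 0 (amp ⟨P.U j, P.U_periodic j, P.contDiff_U (P.δ_pos hδ₀ hd j)⟩ P.γ))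
    (j : ℕ) {v X : ℕ} (hv : 0 < v)
    {ra rb qn qd : ℕ} (Λ0 : ℕ) (hrb : 0 < rb) (hrab : rb < ra) (hΛ0 : 2 ≤ Λ0) (Mb : ℕ) (hqd : 0 < qd) (hΛX : v * Λ0 ≤ X)
    {u' v' : ℕ} (hv' : 0 < v') (hslope : ra * qd * u' ≤ rb * v' * qn)
    (hbase : qd * (u' * (ra - 1) + rb * v') + ra * qd * u' * Λ0 ≤ rb * v' * qn * Λ0) (hQ2 : 2 * qd ≤ qn * Λ0)
    (hgap : v * (ra - 1) * qd + rb * qd + (v * ra * qd + qn * rb) * Λ0 ≤ G * rb * qd * Λ0) (hgapc : v * ra * qd + qn * rb ≤ G * rb * qd)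
    {po : ℕ} (hp : 1 ≤ po) {εg : ℝ} (hεg : 0 < εg)
    {M ε : ℝ} (hM : 1 ≤ M) (hMδ : M * P.δ j < π / 2) (hε : Real.exp (-(M ^ 2 / 2)) ≤ ε)
    {Y : ℕ} (hY : Y ≤ u' * Λ0 / v' + 1)
    {A βs ρs Z : ℝ} (hβs : 0 ≤ βs) (hρs : 0 ≤ ρs)
    (hA : ∑ m ∈ Finset.range Mb, (1 + εg) * ((P.N j : ℝ) ^ 2 / π ^ 2) *
              (8 * ((((Λ0 * ra ^ m / rb ^ m) : ℕ) : ℝ) * G - ((((u' * (Λ0 * ra ^ (m + 1) / rb ^ (m + 1)) / v') + ((qn * (Λ0 * ra ^ m / rb ^ m) / qd) - (u' * (Λ0 * ra ^ (m + 1) / rb ^ (m + 1)) / v')) : ℕ) : ℝ) - 1)) ^ 2 / (((((Λ0 * ra ^ m / rb ^ m) : ℕ) : ℝ) * G - ((((u' * (Λ0 * ra ^ (m + 1) / rb ^ (m + 1)) / v') + ((qn * (Λ0 * ra ^ m / rb ^ m) / qd) - (u' * (Λ0 * ra ^ (m + 1) / rb ^ (m + 1)) / v')) : ℕ) : ℝ)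 - 1)) ^ 2 - ((v * (Λ0 * ra ^ (m + 1) / rb ^ (m + 1)) / 1 : ℕ) : ℝ) ^ 2) ^ 2 +
                8 * (((v * (Λ0 * ra ^ (m + 1) / rb ^ (m + 1)) / 1 : ℕ) : ℝ) + 1 / 2) / (P.N j * (((((Λ0 * ra ^ m / rb ^ m) : ℕ) : ℝ) * G - ((((u' * (Λ0 * ra ^ (m + 1) / rb ^ (m + 1)) / v') + ((qn * (Λ0 * ra ^ m / rb ^ m) / qd) - (u' * (Λ0 * ra ^ (m + 1) / rb ^ (m + 1)) / v')) : ℕ) : ℝ) - 1)) ^ 2 - (((v * (Λ0 * ra ^ (m + 1) / rb ^ (m + 1)) / 1 : ℕ) : ℝ) + 1 / 2) ^ 2))) *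
              ((Real.sqrt ((2 * (u' * (Λ0 * ra ^ (m + 1) / rb ^ (m + 1)) / v') + ((qn * (Λ0 * ra ^ m / rb ^ m) / qd) - (u' * (Λ0 * ra ^ (m + 1) / rb ^ (m + 1)) / v')) : ℕ) * ((((qn * (Λ0 * ra ^ m / rb ^ m) / qd) - (u' * (Λ0 * ra ^ (m + 1) / rb ^ (m + 1)) / v')) : ℕ) : ℝ)) / ((((qn * (Λ0 * ra ^ m / rb ^ m) / qd) - (u' * (Λ0 * ra ^ (m + 1) / rb ^ (m + 1)) / v')) : ℕ) : ℝ) * 1) ^ 2 / 2 + (Real.sqrt ((2 * (u' * (Λ0 * ra ^ (m + 1) / rb ^ (m + 1)) / v') + ((qn * (Λ0 * ra ^ m / rb ^ m) / qd) - (u' * (Λ0 * ra ^ (m + 1) / rb ^ (m + 1)) / v')) : ℕ) * ((((qn * (Λ0 * ra ^ m / rb ^ m) / qd) - (u' * (Λ0 * ra ^ (m + 1) / rb ^ (m + 1)) / v')) : ℕ) : ℝ)) / ((((qn * (Λ0 * ra ^ m / rb ^ m) / qd) - (u' * (Λ0 * ra ^ (m + 1) / rb ^ (m + 1)) / v'))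 : ℕ) : ℝ) * 1) ^ 2 / 2) ≤ A)
    (hβ : ∀ m ∈ Finset.range Mb, (1 + εg⁻¹) * ((P.N j : ℝ) ^ 2 / π ^ 2) * (4 / ((((Λ0 * ra ^ m / rb ^ m) * G - v * (Λ0 * ra ^ (m + 1) / rb ^ (m + 1)) / 1 - ((u' * (Λ0 * ra ^ (m + 1) / rb ^ (m + 1)) / v') + ((qn * (Λ0 * ra ^ m / rb ^ m) / qd) - (u' * (Λ0 * ra ^ (m + 1) / rb ^ (m + 1)) / v'))) : ℕ) : ℝ)) ^ 2 *
              (1 / (((((Λ0 * ra ^ m / rb ^ m) * G - v * (Λ0 * ra ^ (m + 1) / rb ^ (m + 1)) / 1 - ((u' * (Λ0 * ra ^ (m + 1) / rb ^ (m + 1)) / v') + ((qn * (Λ0 * ra ^ m / rb ^ m) / qd) - (u' * (Λ0 * ra ^ (m + 1) / rb ^ (m + 1)) / v'))) : ℕ) : ℝ)) + (((u' * (Λ0 * ra ^ (m + 1) / rb ^ (m + 1)) / v') + ((qn * (Λ0 * ra ^ m / rb ^ m) / qd) - (u' * (Λ0 * ra ^ (m + 1) / rb ^ (m + 1)) / v'))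 : ℕ) : ℝ)) ^ (2 * po) +
                1 / (P.N j * (((((Λ0 * ra ^ m / rb ^ m) * G - v * (Λ0 * ra ^ (m + 1) / rb ^ (m + 1)) / 1 - ((u' * (Λ0 * ra ^ (m + 1) / rb ^ (m + 1)) / v') + ((qn * (Λ0 * ra ^ m / rb ^ m) / qd) - (u' * (Λ0 * ra ^ (m + 1) / rb ^ (m + 1)) / v'))) : ℕ) : ℝ)) + (((u' * (Λ0 * ra ^ (m + 1) / rb ^ (m + 1)) / v') + ((qn * (Λ0 * ra ^ m / rb ^ m) / qd) - (u' * (Λ0 * ra ^ (m + 1) / rb ^ (m + 1)) / v')) : ℕ) : ℝ)) ^ (2 * po - 1)))) *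
              ((2 * (((u' * (Λ0 * ra ^ (m + 1) / rb ^ (m + 1)) / v') + ((qn * (Λ0 * ra ^ m / rb ^ m) / qd) - (u' * (Λ0 * ra ^ (m + 1) / rb ^ (m + 1)) / v')) : ℕ) : ℝ) / P.N j + 1) * (((u' * (Λ0 * ra ^ (m + 1) / rb ^ (m + 1)) / v') + ((qn * (Λ0 * ra ^ m / rb ^ m) / qd) - (u' * (Λ0 * ra ^ (m + 1) / rb ^ (m + 1)) / v')) : ℕ) : ℝ) ^ (2 * po)) ≤ βs)
    (hρ : ∀ m ∈ Finset.range Mb, (π * (((Λ0 * ra ^ (m + 1) / rb ^ (m + 1)) * G : ℕ) : ℝ) * ε / P.N j) ^ 2 ≤ ρs)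
    (hZ : ∑ m ∈ Finset.range Mb, 8 * M * P.δ j / π * ((Real.sqrt ((2 * (u' * (Λ0 * ra ^ (m + 1) / rb ^ (m + 1)) / v') + ((qn * (Λ0 * ra ^ m / rb ^ m) / qd) - (u' * (Λ0 * ra ^ (m + 1) / rb ^ (m + 1)) / v')) : ℕ) * ((((qn * (Λ0 * ra ^ m / rb ^ m) / qd) - (u' * (Λ0 * ra ^ (m + 1) / rb ^ (m + 1)) / v')) : ℕ) : ℝ)) / ((((qn * (Λ0 * ra ^ m / rb ^ m) / qd) - (u' * (Λ0 * ra ^ (m + 1) / rb ^ (m + 1)) / v')) : ℕ) : ℝ) * 1) ^ 2 / 2 +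
        (Real.sqrt ((2 * (u' * (Λ0 * ra ^ (m + 1) / rb ^ (m + 1)) / v') + ((qn * (Λ0 * ra ^ m / rb ^ m) / qd) - (u' * (Λ0 * ra ^ (m + 1) / rb ^ (m + 1)) / v')) : ℕ) * ((((qn * (Λ0 * ra ^ m / rb ^ m) / qd) - (u' * (Λ0 * ra ^ (m + 1) / rb ^ (m + 1)) / v')) : ℕ) : ℝ)) / ((((qn * (Λ0 * ra ^ m / rb ^ m) / qd) - (u' * (Λ0 * ra ^ (m + 1) / rb ^ (m + 1)) / v')) : ℕ) : ℝ) * 1) ^ 2 / 2) ≤ Z) :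
    ∑' k : Fin 2 → ℤ, (if (X : ℤ) ≤ |k 0| ∧ (1 : ℤ) * |k 0| ≤ (v : ℤ) * |k 1| then (1 : ℝ) else 0) *
        ‖mFourierCoeff (fun x => (a (j + 1) x : ℂ)) k‖ ^ 2 ≤
      (Real.sqrt (A + βs / 2) + Real.sqrt (ρs / 2 + Z) +
          Real.sqrt (∑' k : Fin 2 → ℤ, (if (Y : ℤ) ≤ |k 0| ∧ (u' : ℤ) * |k 1| ≤ (v' : ℤ) * |k 0| then (1 : ℝ) else 0) *
            ‖mFourierCoeff (fun x => (b j x : ℂ)) k‖ ^ 2)) ^ 2 +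
        ((1 + P.γ) ^ (2 * (j + 1)) / ((Λ0 * ra ^ Mb / rb ^ Mb : ℕ) : ℝ)) ^ 2   := by
  have hra1 : 1 ≤ ra := by omega
  have hΛmono : Monotone (fun m : ℕ => Λ0 * ra ^ m / rb ^ m) := geom_blocks_monotone hrb hrab.le Λ0
  have hΛge : ∀ m, Λ0 ≤ (fun m : ℕ => Λ0 * ra ^ m / rb ^ m) m := fun m => geom_blocks_ge hrb hrab.le Λ0 m
  have hΛb0 : 1 ≤ (fun m : ℕ => Λ0 * ra ^ m / rb ^ m) 0 := le_trans (by omega) (hΛge 0)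
  have hsucc : ∀ m, rb * (Λ0 * ra ^ (m + 1) / rb ^ (m + 1)) ≤ ra * (Λ0 * ra ^ m / rb ^ m) + (ra - 1) := fun m =>
    geom_blocks_succ_le hrb hra1 Λ0 m
  have hQ12 : ∀ m, u' * (Λ0 * ra ^ (m + 1) / rb ^ (m + 1)) / v' < qn * (Λ0 * ra ^ m / rb ^ m) / qd := fun m =>
    geom_sep hrb hv' hqd (hsucc m) (hΛge m) hslope hbase
  have hRpos : ∀ m, 0 < (fun m : ℕ => (qn * (Λ0 * ra ^ m / rb ^ m) / qd) - (u' * (Λ0 * ra ^ (m + 1) / rb ^ (m + 1)) / v')) m := fun m => Nat.sub_pos_of_lt (hQ12 m)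
  have hLR : ∀ m, 2 ≤ (fun m : ℕ => (u' * (Λ0 * ra ^ (m + 1) / rb ^ (m + 1)) / v')) m + (fun m : ℕ => (qn * (Λ0 * ra ^ m / rb ^ m) / qd) - (u' * (Λ0 * ra ^ (m + 1) / rb ^ (m + 1)) / v')) m := fun m => by
    show 2 ≤ (u' * (Λ0 * ra ^ (m + 1) / rb ^ (m + 1)) / v') + ((qn * (Λ0 * ra ^ m / rb ^ m) / qd) - (u' * (Λ0 * ra ^ (m + 1) / rb ^ (m + 1)) / v'))
    rw [Nat.add_sub_cancel' (hQ12 m).le]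
    refine (Nat.le_div_iff_mul_le hqd).mpr ?_
    exact le_trans hQ2 (Nat.mul_le_mul_left _ (hΛge m))
  have hfeed : ∀ m, u' * (fun m : ℕ => Λ0 * ra ^ m / rb ^ m) (m + 1) ≤ v' * ((fun m : ℕ => (u' * (Λ0 * ra ^ (m + 1) / rb ^ (m + 1)) / v')) m + 1) := fun m =>
    thin_feed u' hv' _
  have hgapm : ∀ m, v * (fun m : ℕ => Λ0 * ra ^ m / rb ^ m) (m + 1) / 1 +
      ((fun m : ℕ => (u' * (Λ0 * ra ^ (m + 1) / rb ^ (m + 1)) / v')) m + (fun m : ℕ => (qn * (Λ0 * ra ^ m / rb ^ m) / qd) - (u' * (Λ0 * ra ^ (m + 1) / rb ^ (m + 1)) / v')) m) + 1 ≤ (fun m : ℕ => Λ0 * ra ^ m / rb ^ m) m * G := fun m => by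
    show v * (Λ0 * ra ^ (m + 1) / rb ^ (m + 1)) / 1 + ((u' * (Λ0 * ra ^ (m + 1) / rb ^ (m + 1)) / v') + ((qn * (Λ0 * ra ^ m / rb ^ m) / qd) - (u' * (Λ0 * ra ^ (m + 1) / rb ^ (m + 1)) / v'))) + 1 ≤ (Λ0 * ra ^ m / rb ^ m) * G
    rw [Nat.div_one, Nat.add_sub_cancel' (hQ12 m).le]
    have h1 := hsucc m
    have h2 : qd * ((qn * (Λ0 * ra ^ m / rb ^ m) / qd)) ≤ qn * (Λ0 * ra ^ m / rb ^ m) := by rw [mul_comm]; exact Nat.div_mul_le_self _ _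
    have h3 : Λ0 ≤ Λ0 * ra ^ m / rb ^ m := hΛge m
    have h4 : v * (ra - 1) * qd + rb * qd + (v * ra * qd + qn * rb) * (Λ0 * ra ^ m / rb ^ m) ≤ G * rb * qd * (Λ0 * ra ^ m / rb ^ m) := by
      obtain ⟨dd, hdd⟩ := Nat.exists_eq_add_of_le h3
      rw [hdd, mul_add, mul_add]
      have h8 := Nat.mul_le_mul_right dd hgapc
      omega
    -- multiply the goal by rb * qd
    have hrq : 0 < rb * qd := Nat.mul_pos hrb hqd
    refine Nat.le_of_mul_le_mul_left ?_ hrq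
    have e1 : rb * qd * (v * (Λ0 * ra ^ (m + 1) / rb ^ (m + 1)) + (qn * (Λ0 * ra ^ m / rb ^ m) / qd) + 1) = v * qd * (rb * (Λ0 * ra ^ (m + 1) / rb ^ (m + 1))) + rb * (qd * (qn * (Λ0 * ra ^ m / rb ^ m) / qd)) + rb * qd := by ring
    rw [e1]
    calc v * qd * (rb * (Λ0 * ra ^ (m + 1) / rb ^ (m + 1))) + rb * (qd * (qn * (Λ0 * ra ^ m / rb ^ m) / qd)) + rb * qd
        ≤ v * qd * (ra * (Λ0 * ra ^ m / rb ^ m) + (ra - 1)) + rb * (qn * (Λ0 * ra ^ m / rb ^ m)) + rb * qd := by gcongr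
      _ ≤ rb * qd * ((Λ0 * ra ^ m / rb ^ m) * G) := by
          have := h4
          ring_nf at this ⊢
          omega
  have hYm : ∀ m, Y ≤ (fun m : ℕ => (u' * (Λ0 * ra ^ (m + 1) / rb ^ (m + 1)) / v')) m + 1 := fun m => by
    have h1 : u' * Λ0 / v' ≤ (u' * (Λ0 * ra ^ (m + 1) / rb ^ (m + 1)) / v') := Nat.div_le_div_right (Nat.mul_le_mul_left _ (hΛge (m + 1)))
    show Y ≤ (u' * (Λ0 * ra ^ (m + 1) / rb ^ (m + 1)) / v') + 1
    omega
  have hΛX' : v * (fun m : ℕ => Λ0 * ra ^ m / rb ^ m) 0 ≤ 1 * X := by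
    show v * (Λ0 * ra ^ 0 / rb ^ 0) ≤ 1 * X
    rw [geom_blocks_zero]; omega
  exact tsum_ratioClass_vstep_blocks_ctg_le P hγ hδ₀ hd hN₀ hρN a b has h0 hb hab j Nat.one_pos hv _ hΛmono hΛb0 Mb hΛX' _ _ hRpos hLR
    hgapm hp hεg hM hMδ hε hfeed hYm hβs hρs hA hβ hρ hZ

set_option maxHeartbeats 800000 in
/-- Geometric-family instantiation (`Λ_m = ⌊Λ₀(r_a/r_b)^m⌋`, plateau `⌊u′Λ_{m+1}/v′⌋`, support `⌊q_nΛ_m/q_d⌋`, box window `vΛ_{m+1}`, `u = 1`) of `tsum_ratioClass_hstep_blocks_ctg_le`; the finite block sums stay as hypotheses for the numeric layer. [cite: Grafakos2014, Prop. 3.1.2 (5), Prop. 3.2.7 (3)] -/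
theorem ratioClass_hstep_geomExplicitCTG_le {G : ℕ} (hγ : P.γ = G) (hδ₀ : 0 < P.δ₀) (hd : 0 < P.d) (hN₀ : 1 ≤ P.N₀)
    (hρN : 1 ≤ P.ρN) (a b : ℕ → UnitAddTorus (Fin 2) → ℝ) (has : ∀ j, IsSmooth (a j)) (h0 : a 0 = datum)
    (hb : ∀ j, b j = a j ∘ shearMap 0 1 (amp ⟨P.U j, P.U_periodic j, P.contDiff_U (P.δ_pos hδ₀ hd j)⟩ P.γ))
    (hab : ∀ j, a (j + 1) = b j ∘ shearMap 1 0 (amp ⟨P.U j, P.U_periodic j, P.contDiff_U (P.δ_pos hδ₀ hd j)⟩ P.γ))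
    (j : ℕ) {v : ℕ} (hv : 0 < v)
    {ra rb qn qd : ℕ} (Λ0 : ℕ) (hrb : 0 < rb) (hrab : rb < ra) (hΛ0 : 2 ≤ Λ0) (Mb : ℕ) (hqd : 0 < qd)
    {u' v' : ℕ} (hv' : 0 < v') (hslope : ra * qd * u' ≤ rb * v' * qn)
    (hbase : qd * (u' * (ra - 1) + rb * v') + ra * qd * u' * Λ0 ≤ rb * v' * qn * Λ0) (hQ2 : 2 * qd ≤ qn * Λ0)
    (hgap : v * (ra - 1) * qd + rb * qd + (v * ra * qd + qn * rb) * Λ0 ≤ G * rb * qd * Λ0) (hgapc : v * ra * qd + qn * rb ≤ G * rb * qd)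
    {po : ℕ} (hp : 1 ≤ po) {εg : ℝ} (hεg : 0 < εg)
    {M ε : ℝ} (hM : 1 ≤ M) (hMδ : M * P.δ j < π / 2) (hε : Real.exp (-(M ^ 2 / 2)) ≤ ε)
    {Y : ℕ} (hY : Y ≤ Λ0)
    {A βs ρs Z : ℝ} (hβs : 0 ≤ βs) (hρs : 0 ≤ ρs)
    (hA : ∑ m ∈ Finset.range Mb, (1 + εg) * ((P.N j : ℝ) ^ 2 / π ^ 2) *
              (8 * ((((Λ0 * ra ^ m / rb ^ m) : ℕ) : ℝ) * G - ((((u' * (Λ0 * ra ^ (m + 1) / rb ^ (m + 1)) / v') + ((qn * (Λ0 * ra ^ m / rb ^ m) / qd) - (u' * (Λ0 * ra ^ (m + 1) / rb ^ (m + 1)) / v')) : ℕ) : ℝ) - 1)) ^ 2 / (((((Λ0 * ra ^ m / rb ^ m) : ℕ) : ℝ) * G - ((((u' * (Λ0 * ra ^ (m + 1) / rb ^ (m + 1)) / v') + ((qn * (Λ0 * ra ^ m / rb ^ m) / qd) - (u' * (Λ0 * ra ^ (m + 1) / rb ^ (m + 1)) / v')) : ℕ) : ℝ) - 1)) ^ 2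 - ((v * (Λ0 * ra ^ (m + 1) / rb ^ (m + 1)) / 1 : ℕ) : ℝ) ^ 2) ^ 2 +
                8 * (((v * (Λ0 * ra ^ (m + 1) / rb ^ (m + 1)) / 1 : ℕ) : ℝ) + 1 / 2) / (P.N j * (((((Λ0 * ra ^ m / rb ^ m) : ℕ) : ℝ) * G - ((((u' * (Λ0 * ra ^ (m + 1) / rb ^ (m + 1)) / v') + ((qn * (Λ0 * ra ^ m / rb ^ m) / qd) - (u' * (Λ0 * ra ^ (m + 1) / rb ^ (m + 1)) / v')) : ℕ) : ℝ) - 1)) ^ 2 - (((v * (Λ0 * ra ^ (m + 1) / rb ^ (m + 1)) / 1 : ℕ) : ℝ) + 1 / 2) ^ 2))) *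
              ((Real.sqrt ((2 * (u' * (Λ0 * ra ^ (m + 1) / rb ^ (m + 1)) / v') + ((qn * (Λ0 * ra ^ m / rb ^ m) / qd) - (u' * (Λ0 * ra ^ (m + 1) / rb ^ (m + 1)) / v')) : ℕ) * ((((qn * (Λ0 * ra ^ m / rb ^ m) / qd) - (u' * (Λ0 * ra ^ (m + 1) / rb ^ (m + 1)) / v')) : ℕ) : ℝ)) / ((((qn * (Λ0 * ra ^ m / rb ^ m) / qd) - (u' * (Λ0 * ra ^ (m + 1) / rb ^ (m + 1)) / v')) : ℕ) : ℝ) * 1) ^ 2 / 2 + (Real.sqrt ((2 * (u' * (Λ0 * ra ^ (m + 1) / rb ^ (m + 1)) / v') + ((qn * (Λ0 * ra ^ m / rb ^ m) / qd) - (u' * (Λ0 * ra ^ (m + 1) / rb ^ (m + 1)) / v')) : ℕ) * ((((qn * (Λ0 * ra ^ m / rb ^ m) / qd) - (u' * (Λ0 * ra ^ (m + 1) / rb ^ (m + 1)) / v')) : ℕ) : ℝ)) / ((((qn * (Λ0 * ra ^ m / rb ^ m) / qd) - (u' * (Λ0 * ra ^ (m + 1) / rb ^ (m + 1)) / v'))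 : ℕ) : ℝ) * 1) ^ 2 / 2) ≤ A)
    (hβ : ∀ m ∈ Finset.range Mb, (1 + εg⁻¹) * ((P.N j : ℝ) ^ 2 / π ^ 2) * (4 / ((((Λ0 * ra ^ m / rb ^ m) * G - v * (Λ0 * ra ^ (m + 1) / rb ^ (m + 1)) / 1 - ((u' * (Λ0 * ra ^ (m + 1) / rb ^ (m + 1)) / v') + ((qn * (Λ0 * ra ^ m / rb ^ m) / qd) - (u' * (Λ0 * ra ^ (m + 1) / rb ^ (m + 1)) / v'))) : ℕ) : ℝ)) ^ 2 *
              (1 / (((((Λ0 * ra ^ m / rb ^ m) * G - v * (Λ0 * ra ^ (m + 1) / rb ^ (m + 1)) / 1 - ((u' * (Λ0 * ra ^ (m + 1) / rb ^ (m + 1)) / v') + ((qn * (Λ0 * ra ^ m / rb ^ m) / qd) - (u' * (Λ0 * ra ^ (m + 1) / rb ^ (m + 1)) / v'))) : ℕ) : ℝ)) + (((u' * (Λ0 * ra ^ (m + 1) / rb ^ (m + 1)) / v') + ((qn * (Λ0 * ra ^ m / rb ^ m) / qd) - (u' * (Λ0 * ra ^ (m + 1) / rb ^ (m + 1)) / v'))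 : ℕ) : ℝ)) ^ (2 * po) +
                1 / (P.N j * (((((Λ0 * ra ^ m / rb ^ m) * G - v * (Λ0 * ra ^ (m + 1) / rb ^ (m + 1)) / 1 - ((u' * (Λ0 * ra ^ (m + 1) / rb ^ (m + 1)) / v') + ((qn * (Λ0 * ra ^ m / rb ^ m) / qd) - (u' * (Λ0 * ra ^ (m + 1) / rb ^ (m + 1)) / v'))) : ℕ) : ℝ)) + (((u' * (Λ0 * ra ^ (m + 1) / rb ^ (m + 1)) / v') + ((qn * (Λ0 * ra ^ m / rb ^ m) / qd) - (u' * (Λ0 * ra ^ (m + 1) / rb ^ (m + 1)) / v')) : ℕ) : ℝ)) ^ (2 * po - 1)))) *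
              ((2 * (((u' * (Λ0 * ra ^ (m + 1) / rb ^ (m + 1)) / v') + ((qn * (Λ0 * ra ^ m / rb ^ m) / qd) - (u' * (Λ0 * ra ^ (m + 1) / rb ^ (m + 1)) / v')) : ℕ) : ℝ) / P.N j + 1) * (((u' * (Λ0 * ra ^ (m + 1) / rb ^ (m + 1)) / v') + ((qn * (Λ0 * ra ^ m / rb ^ m) / qd) - (u' * (Λ0 * ra ^ (m + 1) / rb ^ (m + 1)) / v')) : ℕ) : ℝ) ^ (2 * po)) ≤ βs)
    (hρ : ∀ m ∈ Finset.range Mb, (π * (((Λ0 * ra ^ (m + 1) / rb ^ (m + 1)) * G : ℕ) : ℝ) * ε / P.N j) ^ 2 ≤ ρs)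
    (hZ : ∑ m ∈ Finset.range Mb, 8 * M * P.δ j / π * ((Real.sqrt ((2 * (u' * (Λ0 * ra ^ (m + 1) / rb ^ (m + 1)) / v') + ((qn * (Λ0 * ra ^ m / rb ^ m) / qd) - (u' * (Λ0 * ra ^ (m + 1) / rb ^ (m + 1)) / v')) : ℕ) * ((((qn * (Λ0 * ra ^ m / rb ^ m) / qd) - (u' * (Λ0 * ra ^ (m + 1) / rb ^ (m + 1)) / v')) : ℕ) : ℝ)) / ((((qn * (Λ0 * ra ^ m / rb ^ m) / qd) - (u' * (Λ0 * ra ^ (m + 1) / rb ^ (m + 1)) / v')) : ℕ) : ℝ) * 1) ^ 2 / 2 +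
        (Real.sqrt ((2 * (u' * (Λ0 * ra ^ (m + 1) / rb ^ (m + 1)) / v') + ((qn * (Λ0 * ra ^ m / rb ^ m) / qd) - (u' * (Λ0 * ra ^ (m + 1) / rb ^ (m + 1)) / v')) : ℕ) * ((((qn * (Λ0 * ra ^ m / rb ^ m) / qd) - (u' * (Λ0 * ra ^ (m + 1) / rb ^ (m + 1)) / v')) : ℕ) : ℝ)) / ((((qn * (Λ0 * ra ^ m / rb ^ m) / qd) - (u' * (Λ0 * ra ^ (m + 1) / rb ^ (m + 1)) / v')) : ℕ) : ℝ) * 1) ^ 2 / 2) ≤ Z) :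
    ∑' k : Fin 2 → ℤ, (if ((Λ0 * ra ^ 0 / rb ^ 0 : ℕ) : ℤ) ≤ |k 0| ∧ (1 : ℤ) * |k 1| ≤ (v : ℤ) * |k 0| then (1 : ℝ) else 0) *
        ‖mFourierCoeff (fun x => (b j x : ℂ)) k‖ ^ 2 ≤
      (Real.sqrt (A + βs / 2) + Real.sqrt (ρs / 2 + Z) +
          Real.sqrt (∑' k : Fin 2 → ℤ, (if (Y : ℤ) ≤ |k 0| ∧ (u' : ℤ) * |k 0| ≤ (v' : ℤ) * |k 1| then (1 : ℝ) else 0) *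
            ‖mFourierCoeff (fun x => (a j x : ℂ)) k‖ ^ 2)) ^ 2 +
        ((1 + P.γ) ^ (2 * j) / ((Λ0 * ra ^ Mb / rb ^ Mb : ℕ) : ℝ)) ^ 2   := by
  have hra1 : 1 ≤ ra := by omega
  have hΛmono : Monotone (fun m : ℕ => Λ0 * ra ^ m / rb ^ m) := geom_blocks_monotone hrb hrab.le Λ0
  have hΛge : ∀ m, Λ0 ≤ (fun m : ℕ => Λ0 * ra ^ m / rb ^ m) m := fun m => geom_blocks_ge hrb hrab.le Λ0 m
  have hΛb0 : 1 ≤ (fun m : ℕ => Λ0 * ra ^ m / rb ^ m) 0 := le_trans (by omega) (hΛge 0)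
  have hsucc : ∀ m, rb * (Λ0 * ra ^ (m + 1) / rb ^ (m + 1)) ≤ ra * (Λ0 * ra ^ m / rb ^ m) + (ra - 1) := fun m =>
    geom_blocks_succ_le hrb hra1 Λ0 m
  have hQ12 : ∀ m, u' * (Λ0 * ra ^ (m + 1) / rb ^ (m + 1)) / v' < qn * (Λ0 * ra ^ m / rb ^ m) / qd := fun m =>
    geom_sep hrb hv' hqd (hsucc m) (hΛge m) hslope hbase
  have hRpos : ∀ m, 0 < (fun m : ℕ => (qn * (Λ0 * ra ^ m / rb ^ m) / qd) - (u' * (Λ0 * ra ^ (m + 1) / rb ^ (m + 1)) / v')) m := fun m => Nat.sub_pos_of_lt (hQ12 m)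
  have hLR : ∀ m, 2 ≤ (fun m : ℕ => (u' * (Λ0 * ra ^ (m + 1) / rb ^ (m + 1)) / v')) m + (fun m : ℕ => (qn * (Λ0 * ra ^ m / rb ^ m) / qd) - (u' * (Λ0 * ra ^ (m + 1) / rb ^ (m + 1)) / v')) m := fun m => by
    show 2 ≤ (u' * (Λ0 * ra ^ (m + 1) / rb ^ (m + 1)) / v') + ((qn * (Λ0 * ra ^ m / rb ^ m) / qd) - (u' * (Λ0 * ra ^ (m + 1) / rb ^ (m + 1)) / v'))
    rw [Nat.add_sub_cancel' (hQ12 m).le]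
    refine (Nat.le_div_iff_mul_le hqd).mpr ?_
    exact le_trans hQ2 (Nat.mul_le_mul_left _ (hΛge m))
  have hfeed : ∀ m, u' * (fun m : ℕ => Λ0 * ra ^ m / rb ^ m) (m + 1) ≤ v' * ((fun m : ℕ => (u' * (Λ0 * ra ^ (m + 1) / rb ^ (m + 1)) / v')) m + 1) := fun m =>
    thin_feed u' hv' _
  have hgapm : ∀ m, v * (fun m : ℕ => Λ0 * ra ^ m / rb ^ m) (m + 1) / 1 +
      ((fun m : ℕ => (u' * (Λ0 * ra ^ (m + 1) / rb ^ (m + 1)) / v')) m + (fun m : ℕ => (qn * (Λ0 * ra ^ m / rb ^ m) / qd) - (u' * (Λ0 * ra ^ (m + 1) / rb ^ (m + 1)) / v')) m) + 1 ≤ (fun m : ℕ => Λ0 * ra ^ m / rb ^ m) m * G := fun m => by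
    show v * (Λ0 * ra ^ (m + 1) / rb ^ (m + 1)) / 1 + ((u' * (Λ0 * ra ^ (m + 1) / rb ^ (m + 1)) / v') + ((qn * (Λ0 * ra ^ m / rb ^ m) / qd) - (u' * (Λ0 * ra ^ (m + 1) / rb ^ (m + 1)) / v'))) + 1 ≤ (Λ0 * ra ^ m / rb ^ m) * G
    rw [Nat.div_one, Nat.add_sub_cancel' (hQ12 m).le]
    have h1 := hsucc m
    have h2 : qd * ((qn * (Λ0 * ra ^ m / rb ^ m) / qd)) ≤ qn * (Λ0 * ra ^ m / rb ^ m) := by rw [mul_comm]; exact Nat.div_mul_le_self _ _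
    have h3 : Λ0 ≤ Λ0 * ra ^ m / rb ^ m := hΛge m
    have h4 : v * (ra - 1) * qd + rb * qd + (v * ra * qd + qn * rb) * (Λ0 * ra ^ m / rb ^ m) ≤ G * rb * qd * (Λ0 * ra ^ m / rb ^ m) := by
      obtain ⟨dd, hdd⟩ := Nat.exists_eq_add_of_le h3
      rw [hdd, mul_add, mul_add]
      have h8 := Nat.mul_le_mul_right dd hgapc
      omega
    -- multiply the goal by rb * qd
    have hrq : 0 < rb * qd := Nat.mul_pos hrb hqd
    refine Nat.le_of_mul_le_mul_left ?_ hrq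
    have e1 : rb * qd * (v * (Λ0 * ra ^ (m + 1) / rb ^ (m + 1)) + (qn * (Λ0 * ra ^ m / rb ^ m) / qd) + 1) = v * qd * (rb * (Λ0 * ra ^ (m + 1) / rb ^ (m + 1))) + rb * (qd * (qn * (Λ0 * ra ^ m / rb ^ m) / qd)) + rb * qd := by ring
    rw [e1]
    calc v * qd * (rb * (Λ0 * ra ^ (m + 1) / rb ^ (m + 1))) + rb * (qd * (qn * (Λ0 * ra ^ m / rb ^ m) / qd)) + rb * qd
        ≤ v * qd * (ra * (Λ0 * ra ^ m / rb ^ m) + (ra - 1)) + rb * (qn * (Λ0 * ra ^ m / rb ^ m)) + rb * qd := by gcongr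
      _ ≤ rb * qd * ((Λ0 * ra ^ m / rb ^ m) * G) := by
          have := h4
          ring_nf at this ⊢
          omega
  have hY' : Y ≤ (fun m : ℕ => Λ0 * ra ^ m / rb ^ m) 0 := by
    show Y ≤ Λ0 * ra ^ 0 / rb ^ 0
    rw [geom_blocks_zero]; exact hY
  exact tsum_ratioClass_hstep_blocks_ctg_le P hγ hδ₀ hd hN₀ hρN a b has h0 hb hab j Nat.one_pos hv _ hΛmono hΛb0 Mb _ _ hRpos hLR
    hgapm hp hεg hM hMδ hε hfeed hY' hβs hρs hA hβ hρ hZ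

end Cascade

end Summit.AnomalousDissipation.AnomalousDissipation.Theorems.SawtoothPulseCascade.K1Window
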